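import Summits.QuantumFields.YangMills.Theorems.IR.BetaSlopeFloorRungSkew

/-!
# Line `beta-slope-floor` (crux `IR`, stmt-QuantumFields-19354): doubled Haar moments vanish below order `2n`

Route `BalabanLadder`, crux `IR`, line `beta-slope-floor` (registered stub `stub_rung_strongCoupling`), lead
prover `ym-ir-line-bsf-p1`.  Upgrade of `integral_doubledMoment_eq_zero` (file `…RungMoments`, order `< n`)
to order `< 2n` (`integral_doubledMoment_eq_zero_two`): `2n` is the slope constant of the registered rung.
A `j`-tuple of plaquettes with `j < 2n` leaves a forward step `t < n` and a backward step `t' ≥ n` with AT MOST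
ONE timelike plaquette each (`exists_thin_steps`); the composite symmetry `sigma = slabSwap ∘ skew4` of file
`…RungSkew` (slab swap + four skew left translations of the cut plaquettes' base links) preserves product Haar
measure (`integral_comp_sigma`), fixes `F` and every plaquette factor (`dTerm_sigma_*`), and flips
`G(U) − G(U')` (`integrand_sigma`): the integrand is odd and the moment vanishes.

Honest framing: strong-coupling combinatorics on a finite torus, group-blind; nothing here bears on the
Yang–Mills mass gap (Clay).  R4 of the ladder closes only the conditional finite-𝕋⁴ rung `BalabanLadder.UV`.
Refs: K. Osterwalder, E. Seiler, Ann. Phys. 110 (1978) 440, §3; line card `Cruxes/IR/Lines/beta-slope-floor.md`.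
-/

set_option autoImplicit false

noncomputable section

open MeasureTheory Function Classical
open Literature.MathematicalPhysics.QuantumFieldTheory

namespace Summit.QuantumFields.YangMills.Cruxes.IR.BetaSlopeFloor

/-! ## §3 Invariance of the plaquette factors and oddness of the integrand under `Σ` -/

section Invariance

variable {L : ℕ} {G : Type*} [Group G] {N : ℕ} (ρ : G →* Matrix (Fin N) (Fin N) ℂ)
  {n t t' : ℕ} {x : Site 4 L} {j : Fin 4} {y : Site 4 L} {j' : Fin 4}

/-- The doubled plaquette term in the `emb` bookkeeping. -/
theorem dTerm_eq_emb (p : Plaquette 4 L) (W : Edge 4 L ⊕ Edge 4 L → G) :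
    dTerm ρ p W = plaquetteCost ρ (fun e => W (emb false e)) p + plaquetteCost ρ (fun e => W (emb true e)) p :=
  rfl

/-- A plaquette TIMELIKE-FREE of the cut steps: not a timelike plaquette based at time `t` or `t'`. -/
def TFree (t t' : ℕ) (p : Plaquette 4 L) : Prop := p.2.1.1 = 0 → (p.1 0).val ≠ t ∧ (p.1 0).val ≠ t'

/-- A timelike-free plaquette has all four links swapped or none (refines `inSwap_edges_of_freeOf`). -/
theorem inSwap_edges_of_tfree [NeZero L] (hL : 1 < L) (htt' : t < t') (ht'L : t' < L) {p : Plaquette 4 L}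
    (hp : TFree t t' p) :
    (InSwap t t' (p.1, p.2.1.1) ∧ InSwap t t' (p.1.shift p.2.1.1, p.2.1.2) ∧
        InSwap t t' (p.1.shift p.2.1.2, p.2.1.1) ∧ InSwap t t' (p.1, p.2.1.2)) ∨
      (¬ InSwap t t' (p.1, p.2.1.1) ∧ ¬ InSwap t t' (p.1.shift p.2.1.1, p.2.1.2) ∧
        ¬ InSwap t t' (p.1.shift p.2.1.2, p.2.1.1) ∧ ¬ InSwap t t' (p.1, p.2.1.2)) := by
  obtain ⟨z, ⟨⟨i, k⟩, hik⟩⟩ := p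
  simp only at hik
  have hk : k ≠ 0 := by
    rintro rfl; exact (Fin.not_lt_zero _ hik).elim
  by_cases hi : i = 0
  · subst hi
    obtain ⟨hst, hst'⟩ := hp rfl
    have key := inSlab_iff_inSlab_add_one hL htt' ht'L (z 0) hst hst'
    simp only [InSwap, if_true, hk, if_false, shift_time_zero, shift_time_of_ne z hk]
    tauto
  · simp only [InSwap, hi, if_false, hk, shift_time_of_ne z hi, shift_time_of_ne z hk]
    tauto

/-- Timelike-free plaquette factors are invariant under the slab swap. -/
theorem dTerm_slabSwap_of_tfree [NeZero L] (hL : 1 < L) (htt' : t < t') (ht'L : t' < L) {p : Plaquette 4 L}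
    (hp : TFree t t' p) (W : Edge 4 L ⊕ Edge 4 L → G) : dTerm ρ p (slabSwap t t' W) = dTerm ρ p W := by
  rcases inSwap_edges_of_tfree hL htt' ht'L hp with ⟨h1, h2, h3, h4⟩ | ⟨h1, h2, h3, h4⟩
  · simp only [dTerm, plaquetteCost, plaquetteHolonomy, slabSwap_inl_of h1, slabSwap_inl_of h2,
      slabSwap_inl_of h3, slabSwap_inl_of h4, slabSwap_inr_of h1, slabSwap_inr_of h2,
      slabSwap_inr_of h3, slabSwap_inr_of h4]
    ring
  · simp only [dTerm, plaquetteCost, plaquetteHolonomy, slabSwap_inl_of_not h1, slabSwap_inl_of_not h2,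
      slabSwap_inl_of_not h3, slabSwap_inl_of_not h4, slabSwap_inr_of_not h1, slabSwap_inr_of_not h2,
      slabSwap_inr_of_not h3, slabSwap_inr_of_not h4]

/-- **Timelike-free plaquette factors are invariant under `Σ`** (they read no base link, so `Σ` acts on them as
the slab swap). -/
theorem dTerm_sigma_of_tfree [NeZero L] (c : CutData L n t t' x j y j') {p : Plaquette 4 L} (hp : TFree t t' p)
    (W : Edge 4 L ⊕ Edge 4 L → G) : dTerm ρ p (sigma t t' x j y j' W) = dTerm ρ p W := by
  rw [← dTerm_slabSwap_of_tfree ρ c.hL (lt_of_lt_of_le c.htn c.hnt') c.ht'L hp W]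
  obtain ⟨z, ⟨⟨i, k⟩, hik⟩⟩ := p
  simp only at hik
  have hk : k ≠ 0 := by
    rintro rfl; exact (Fin.not_lt_zero _ hik).elim
  -- the four links of `p` avoid both base links
  have hne : ∀ e ∈ [(z, i), (z.shift i, k), (z.shift k, i), (z, k)], e ≠ (x, 0) ∧ e ≠ (y, 0) := by
    intro e he
    simp only [List.mem_cons, List.mem_nil_iff, or_false] at he
    by_cases hi : i = 0
    · subst hi
      obtain ⟨hst, hst'⟩ := hp rfl
      have hzx : z ≠ x := fun h => hst (by rw [h, c.hx])
      have hzy : z ≠ y := fun h => hst' (by rw [h, c.hy])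
      have hzx' : z.shift k ≠ x := fun h => hst (by rw [← c.hx, ← h, shift_time_of_ne z hk])
      have hzy' : z.shift k ≠ y := fun h => hst' (by rw [← c.hy, ← h, shift_time_of_ne z hk])
      rcases he with rfl | rfl | rfl | rfl
      · exact ⟨fun h => hzx (Prod.ext_iff.1 h).1, fun h => hzy (Prod.ext_iff.1 h).1⟩
      · exact ⟨fun h => hk (Prod.ext_iff.1 h).2, fun h => hk (Prod.ext_iff.1 h).2⟩
      · exact ⟨fun h => hzx' (Prod.ext_iff.1 h).1, fun h => hzy' (Prod.ext_iff.1 h).1⟩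
      · exact ⟨fun h => hk (Prod.ext_iff.1 h).2, fun h => hk (Prod.ext_iff.1 h).2⟩
    · rcases he with rfl | rfl | rfl | rfl
      · exact ⟨fun h => hi (Prod.ext_iff.1 h).2, fun h => hi (Prod.ext_iff.1 h).2⟩
      · exact ⟨fun h => hk (Prod.ext_iff.1 h).2, fun h => hk (Prod.ext_iff.1 h).2⟩
      · exact ⟨fun h => hi (Prod.ext_iff.1 h).2, fun h => hi (Prod.ext_iff.1 h).2⟩
      · exact ⟨fun h => hk (Prod.ext_iff.1 h).2, fun h => hk (Prod.ext_iff.1 h).2⟩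
  have e1 := hne (z, i) (by simp)
  have e2 := hne (z.shift i, k) (by simp)
  have e3 := hne (z.shift k, i) (by simp)
  have e4 := hne (z, k) (by simp)
  simp only [dTerm_eq_emb, plaquetteCost, plaquetteHolonomy, sigma_apply_of_ne W _ e1.1 e1.2,
    sigma_apply_of_ne W _ e2.1 e2.2, sigma_apply_of_ne W _ e3.1 e3.2, sigma_apply_of_ne W _ e4.1 e4.2]

/-- **The cut plaquette at `x` is invariant under `Σ`** (skew re-alignment + class function). -/
theorem dTerm_sigma_x [NeZero L] (c : CutData L n t t' x j y j') {h0j : (0 : Fin 4) < j}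
    (W : Edge 4 L ⊕ Edge 4 L → G) :
    dTerm ρ (x, ⟨(0, j), h0j⟩) (sigma t t' x j y j' W) = dTerm ρ (x, ⟨(0, j), h0j⟩) W := by
  obtain ⟨hxy, hxx, hxy', hyy, hyx⟩ := c.sites_ne
  have hcopy : ∀ b : Bool, plaquetteCost ρ (fun e => sigma t t' x j y j' W (emb b e)) (x, ⟨(0, j), h0j⟩) =
      plaquetteCost ρ (fun e => W (emb b e)) (x, ⟨(0, j), h0j⟩) := by
    intro b
    simp only [plaquetteCost]
    congr 1
    rw [plaquetteHolonomy_eq_mul_restHol, plaquetteHolonomy_eq_mul_restHol, sigma_apply_x c W b]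
    have hrest : restHol b x j (sigma t t' x j y j' W) = restHol b x j (slabSwap t t' W) := by
      simp only [restHol]
      rw [sigma_apply_of_ne W b (fun h => c.hj (Prod.ext_iff.1 h).2) (fun h => c.hj (Prod.ext_iff.1 h).2),
        sigma_apply_of_ne W b (fun h => hxx (Prod.ext_iff.1 h).1) (fun h => hxy' (Prod.ext_iff.1 h).1),
        sigma_apply_of_ne W b (fun h => c.hj (Prod.ext_iff.1 h).2) (fun h => c.hj (Prod.ext_iff.1 h).2)]
    rw [hrest, skewCoeff, trace_re_realign]
  rw [dTerm_eq_emb, dTerm_eq_emb, hcopy false, hcopy true]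

/-- **The cut plaquette at `y` is invariant under `Σ`.** -/
theorem dTerm_sigma_y [NeZero L] (c : CutData L n t t' x j y j') {h0j : (0 : Fin 4) < j'}
    (W : Edge 4 L ⊕ Edge 4 L → G) :
    dTerm ρ (y, ⟨(0, j'), h0j⟩) (sigma t t' x j y j' W) = dTerm ρ (y, ⟨(0, j'), h0j⟩) W := by
  obtain ⟨hxy, hxx, hxy', hyy, hyx⟩ := c.sites_ne
  have hcopy : ∀ b : Bool, plaquetteCost ρ (fun e => sigma t t' x j y j' W (emb b e)) (y, ⟨(0, j'), h0j⟩) =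
      plaquetteCost ρ (fun e => W (emb b e)) (y, ⟨(0, j'), h0j⟩) := by
    intro b
    simp only [plaquetteCost]
    congr 1
    rw [plaquetteHolonomy_eq_mul_restHol, plaquetteHolonomy_eq_mul_restHol, sigma_apply_y c W b]
    have hrest : restHol b y j' (sigma t t' x j y j' W) = restHol b y j' (slabSwap t t' W) := by
      simp only [restHol]
      rw [sigma_apply_of_ne W b (fun h => c.hj' (Prod.ext_iff.1 h).2) (fun h => c.hj' (Prod.ext_iff.1 h).2),
        sigma_apply_of_ne W b (fun h => hyx (Prod.ext_iff.1 h).1) (fun h => hyy (Prod.ext_iff.1 h).1),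
        sigma_apply_of_ne W b (fun h => c.hj' (Prod.ext_iff.1 h).2) (fun h => c.hj' (Prod.ext_iff.1 h).2)]
    rw [hrest, skewCoeff, trace_re_realign]
  rw [dTerm_eq_emb, dTerm_eq_emb, hcopy false, hcopy true]

/-- **The integrand is odd under `Σ`.**  If the only timelike plaquettes of the tuple at the cut steps are the
two cut plaquettes, then `F` is fixed, `Gd` trades copies and every factor is fixed. -/
theorem integrand_sigma [NeZero L] (c : CutData L n t t' x j y j') {h0j : (0 : Fin 4) < j} {h0j' : (0 : Fin 4) < j'}
    {F Gd : GaugeConfig 4 L G → ℝ} (hF : DependsOn F {e : Edge 4 L | e.1 0 = 0 ∧ e.2 ≠ 0})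
    (hG : DependsOn Gd {e : Edge 4 L | e.1 0 = (n : ZMod L) ∧ e.2 ≠ 0})
    {m : ℕ} {f : Fin m → Plaquette 4 L}
    (hfx : ∀ k, (f k).2.1.1 = 0 → ((f k).1 0).val = t → f k = (x, ⟨(0, j), h0j⟩))
    (hfy : ∀ k, (f k).2.1.1 = 0 → ((f k).1 0).val = t' → f k = (y, ⟨(0, j'), h0j'⟩))
    (W : Edge 4 L ⊕ Edge 4 L → G) :
    F (fun e => sigma t t' x j y j' W (Sum.inl e)) *
        (Gd (fun e => sigma t t' x j y j' W (Sum.inl e)) - Gd (fun e => sigma t t' x j y j' W (Sum.inr e))) *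
          ∏ k, dTerm ρ (f k) (sigma t t' x j y j' W) =
      -(F (fun e => W (Sum.inl e)) * (Gd (fun e => W (Sum.inl e)) - Gd (fun e => W (Sum.inr e))) *
          ∏ k, dTerm ρ (f k) W) := by
  have hnL : n < L := lt_of_le_of_lt c.hnt' c.ht'L
  -- spatial links: `Σ` acts as the slab swap
  have hsp : ∀ (b : Bool) (e : Edge 4 L), e.2 ≠ 0 →
      sigma t t' x j y j' W (emb b e) = slabSwap t t' W (emb b e) := fun b e he =>
    sigma_apply_of_ne W b (fun h => he (Prod.ext_iff.1 h).2) (fun h => he (Prod.ext_iff.1 h).2)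
  have h1 : F (fun e => sigma t t' x j y j' W (Sum.inl e)) = F (fun e => W (Sum.inl e)) :=
    hF fun e he => by
      rw [show (Sum.inl e : Edge 4 L ⊕ Edge 4 L) = emb false e from rfl, hsp false e he.2]
      exact slabSwap_inl_of_not (not_inSwap_of_time_zero he) W
  have h2 : Gd (fun e => sigma t t' x j y j' W (Sum.inl e)) = Gd (fun e => W (Sum.inr e)) :=
    hG fun e he => by
      rw [show (Sum.inl e : Edge 4 L ⊕ Edge 4 L) = emb false e from rfl, hsp false e he.2]
      exact slabSwap_inl_of (inSwap_of_time_eq c.htn c.hnt' hnL he) W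
  have h3 : Gd (fun e => sigma t t' x j y j' W (Sum.inr e)) = Gd (fun e => W (Sum.inl e)) :=
    hG fun e he => by
      rw [show (Sum.inr e : Edge 4 L ⊕ Edge 4 L) = emb true e from rfl, hsp true e he.2]
      exact slabSwap_inr_of (inSwap_of_time_eq c.htn c.hnt' hnL he) W
  have h4 : ∏ k, dTerm ρ (f k) (sigma t t' x j y j' W) = ∏ k, dTerm ρ (f k) W := by
    refine Finset.prod_congr rfl fun k _ => ?_
    by_cases htime : (f k).2.1.1 = 0
    · by_cases hvt : ((f k).1 0).val = t
      · rw [hfx k htime hvt]; exact dTerm_sigma_x ρ c W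
      · by_cases hvt' : ((f k).1 0).val = t'
        · rw [hfy k htime hvt']; exact dTerm_sigma_y ρ c W
        · exact dTerm_sigma_of_tfree ρ c (fun _ => ⟨hvt, hvt'⟩) W
    · exact dTerm_sigma_of_tfree ρ c (fun h => (htime h).elim) W
  rw [h1, h2, h3, h4]
  ring

end Invariance

/-! ## §4 Pigeonhole with multiplicity one, measure preservation, and the vanishing -/

section Moments

variable {L : ℕ} {G : Type*}

/-- **Thin steps exist.**  A tuple of `m < 2n` plaquettes on the torus of time extent `L > 2n` has a forward
step `t < n` and a backward step `n ≤ t' < L` each carrying at most one timelike plaquette of the tuple, i.e.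
all timelike entries at that step coincide with one timelike plaquette based there. -/
theorem exists_thin_steps [NeZero L] {n m : ℕ} (hm : m < 2 * n) (hnL : 2 * n < L)
    (f : Fin m → Plaquette 4 L) :
    ∃ (t t' : ℕ) (x : Site 4 L) (j : Fin 4) (h0j : (0 : Fin 4) < j) (y : Site 4 L) (j' : Fin 4)
      (h0j' : (0 : Fin 4) < j'), t < n ∧ n ≤ t' ∧ t' < L ∧ (x 0).val = t ∧ (y 0).val = t' ∧
      (∀ k, (f k).2.1.1 = 0 → ((f k).1 0).val = t → f k = (x, ⟨(0, j), h0j⟩)) ∧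
      (∀ k, (f k).2.1.1 = 0 → ((f k).1 0).val = t' → f k = (y, ⟨(0, j'), h0j'⟩)) := by
  set Tk : Finset (Fin m) := Finset.univ.filter fun k => (f k).2.1.1 = 0 with hTk
  set g : Fin m → ℕ := fun k => ((f k).1 0).val with hg
  have hTkcard : Tk.card ≤ m := le_trans (Finset.card_filter_le _ _) (by simp)
  -- a thin step in a window `I` of more than `m/2` steps
  have thin : ∀ I : Finset ℕ, m < 2 * I.card → ∃ s ∈ I, (Tk.filter fun k => g k = s).card ≤ 1 := by
    intro I hI
    by_contra hcon
    push Not at hcon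
    have hsum : I.card • 2 ≤ ∑ s ∈ I, (Tk.filter fun k => g k = s).card :=
      Finset.card_nsmul_le_sum I _ 2 fun s hs => hcon s hs
    rw [Finset.sum_card_fiberwise_eq_card_filter] at hsum
    have : (Tk.filter fun k => g k ∈ I).card ≤ Tk.card := Finset.card_filter_le _ _
    rw [smul_eq_mul] at hsum
    omega
  obtain ⟨t, ht, htthin⟩ := thin (Finset.range n) (by rw [Finset.card_range]; omega)
  obtain ⟨t', ht', ht'thin⟩ := thin (Finset.Ico n L) (by rw [Nat.card_Ico]; omega)
  rw [Finset.mem_range] at ht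
  rw [Finset.mem_Ico] at ht'
  -- a timelike plaquette based at a given step, agreeing with all timelike entries there
  have pick : ∀ s : ℕ, s < L → (Tk.filter fun k => g k = s).card ≤ 1 →
      ∃ (x : Site 4 L) (j : Fin 4) (h0j : (0 : Fin 4) < j), (x 0).val = s ∧
        ∀ k, (f k).2.1.1 = 0 → ((f k).1 0).val = s → f k = (x, ⟨(0, j), h0j⟩) := by
    intro s hsL hs
    have hmem : ∀ k, k ∈ (Tk.filter fun k => g k = s) ↔ (f k).2.1.1 = 0 ∧ ((f k).1 0).val = s :=
      fun k => by simp [hTk, hg]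
    by_cases hne : (Tk.filter fun k => g k = s).Nonempty
    · obtain ⟨k₀, hk₀⟩ := hne
      obtain ⟨hi0, hzs⟩ := (hmem k₀).1 hk₀
      rcases hfk : f k₀ with ⟨z, ⟨⟨i, jj⟩, hij⟩⟩
      rw [hfk] at hi0 hzs
      simp only at hi0 hzs hij
      subst hi0
      refine ⟨z, jj, hij, hzs, fun k hk hks => ?_⟩
      have := Finset.card_le_one.1 hs k ((hmem k).2 ⟨hk, hks⟩) k₀ hk₀
      rw [this, hfk]
    · refine ⟨fun i => if i = 0 then (s : ZMod L) else 0, 1, by decide, ?_, fun k hk hks => ?_⟩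
      · simp [ZMod.val_natCast, Nat.mod_eq_of_lt hsL]
      · exact (hne ⟨k, (hmem k).2 ⟨hk, hks⟩⟩).elim
  obtain ⟨x, j, h0j, hx, hfx⟩ := pick t (by omega) htthin
  obtain ⟨y, j', h0j', hy, hfy⟩ := pick t' ht'.2 ht'thin
  exact ⟨t, t', x, j, h0j, y, j', h0j', ht, ht'.1, ht'.2, hx, hy, hfx, hfy⟩

variable [Group G] [TopologicalSpace G] [IsTopologicalGroup G] [MeasurableSpace G] [BorelSpace G]
  [SecondCountableTopology G] [CompactSpace G] {N : ℕ} (ρ : G →* Matrix (Fin N) (Fin N) ℂ)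

omit [Group G] [TopologicalSpace G] [IsTopologicalGroup G] [BorelSpace G] [SecondCountableTopology G]
  [CompactSpace G] in
/-- The slab swap is measurable. -/
theorem measurable_slabSwap (t t' : ℕ) : Measurable (slabSwap (L := L) (G := G) t t') :=
  measurable_pi_lambda _ fun _ => measurable_pi_apply _

omit [CompactSpace G] in
/-- The skew coefficient is measurable. -/
theorem measurable_skewCoeff (t t' : ℕ) (b : Bool) (x : Site 4 L) (j : Fin 4) :
    Measurable (skewCoeff (G := G) t t' b x j) := by
  unfold skewCoeff restHol
  have hs := measurable_slabSwap (L := L) (G := G) t t'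
  have hev : ∀ i : Edge 4 L ⊕ Edge 4 L, Measurable fun W : Edge 4 L ⊕ Edge 4 L → G => slabSwap t t' W i :=
    fun i => (measurable_pi_apply i).comp hs
  fun_prop

omit [CompactSpace G] in
/-- The skew translation of a base link is measurable. -/
theorem measurable_skewAt (t t' : ℕ) (b : Bool) (x : Site 4 L) (j : Fin 4) :
    Measurable (skewAt (G := G) t t' b x j) :=
  measurable_update_mul (emb b (x, 0)) (measurable_skewCoeff t t' b x j)

omit [TopologicalSpace G] [IsTopologicalGroup G] [MeasurableSpace G] [BorelSpace G]
  [SecondCountableTopology G] [CompactSpace G] in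
/-- The skew coefficient is blind to its own base link. -/
theorem skewCoeff_update_self (hL : 1 < L) (t t' : ℕ) (b : Bool) (x : Site 4 L) {j : Fin 4}
    (hj : j ≠ 0) (W : Edge 4 L ⊕ Edge 4 L → G) (v : G) :
    skewCoeff t t' b x j (update W (emb b (x, 0)) v) = skewCoeff t t' b x j W :=
  skewCoeff_update t t' (fun _ => emb_spatial_ne hj) (fun _ => emb_time_ne (shift_ne_self hL x j).symm)
    (fun _ => emb_spatial_ne hj) W v

/-- **`Σ` preserves all product-Haar integrals** (four skew translations and one relabelling). -/
theorem integral_comp_sigma [NeZero L] (hL : 1 < L) (t t' : ℕ) (x : Site 4 L) {j : Fin 4} (hj : j ≠ 0)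
    (y : Site 4 L) {j' : Fin 4} (hj' : j' ≠ 0) {I : (Edge 4 L ⊕ Edge 4 L → G) → ℝ} (hI : Measurable I) :
    ∫ W, I (sigma t t' x j y j' W) ∂(Measure.pi fun _ : Edge 4 L ⊕ Edge 4 L => haarProbability G) =
      ∫ W, I W ∂(Measure.pi fun _ : Edge 4 L ⊕ Edge 4 L => haarProbability G) := by
  have hsw := integral_comp_equiv (haarProbability G) (slabEquiv (L := L) t t') hI
  -- peel the four skew translations, innermost last
  have step : ∀ (b : Bool) (z : Site 4 L) (jj : Fin 4), jj ≠ 0 →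
      ∀ {J : (Edge 4 L ⊕ Edge 4 L → G) → ℝ}, Measurable J →
        ∫ W, J (skewAt t t' b z jj W) ∂(Measure.pi fun _ : Edge 4 L ⊕ Edge 4 L => haarProbability G) =
          ∫ W, J W ∂(Measure.pi fun _ : Edge 4 L ⊕ Edge 4 L => haarProbability G) :=
    fun b z jj hjj J hJ => integral_comp_update_mul (haarProbability G) (emb b (z, 0))
      (measurable_skewCoeff t t' b z jj) (skewCoeff_update_self hL t t' b z hjj) hJ
  have hm1 := measurable_skewAt (L := L) (G := G) t t' true x j
  have hm2 := measurable_skewAt (L := L) (G := G) t t' false y j'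
  have hm3 := measurable_skewAt (L := L) (G := G) t t' true y j'
  have hS := measurable_slabSwap (L := L) (G := G) t t'
  calc ∫ W, I (sigma t t' x j y j' W) ∂(Measure.pi fun _ : Edge 4 L ⊕ Edge 4 L => haarProbability G)
      = ∫ W, (I ∘ slabSwap t t' ∘ skewAt t t' true y j' ∘ skewAt t t' false y j' ∘ skewAt t t' true x j)
          (skewAt t t' false x j W) ∂(Measure.pi fun _ : Edge 4 L ⊕ Edge 4 L => haarProbability G) := rfl
    _ = ∫ W, (I ∘ slabSwap t t' ∘ skewAt t t' true y j' ∘ skewAt t t' false y j')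
          (skewAt t t' true x j W) ∂(Measure.pi fun _ : Edge 4 L ⊕ Edge 4 L => haarProbability G) :=
        step false x j hj ((((hI.comp hS).comp hm3).comp hm2).comp hm1)
    _ = ∫ W, (I ∘ slabSwap t t' ∘ skewAt t t' true y j') (skewAt t t' false y j' W)
          ∂(Measure.pi fun _ : Edge 4 L ⊕ Edge 4 L => haarProbability G) :=
        step true x j hj (((hI.comp hS).comp hm3).comp hm2)
    _ = ∫ W, (I ∘ slabSwap t t') (skewAt t t' true y j' W)
          ∂(Measure.pi fun _ : Edge 4 L ⊕ Edge 4 L => haarProbability G) :=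
        step false y j' hj' ((hI.comp hS).comp hm3)
    _ = ∫ W, I (slabSwap t t' W) ∂(Measure.pi fun _ : Edge 4 L ⊕ Edge 4 L => haarProbability G) :=
        step true y j' hj' (hI.comp hS)
    _ = ∫ W, I W ∂(Measure.pi fun _ : Edge 4 L ⊕ Edge 4 L => haarProbability G) := hsw

/-- **Vanishing of the doubled Haar moments below order `2n`.**  On the torus `(ℤ/L)⁴` with product Haar
measure on the doubled link configuration, for a time-zero slice observable `F`, a time-`n` slice observable
`Gd` (`2n < L`) and every `j < 2n`: `∫ F(U) (Gd(U) − Gd(U')) (S(U) + S(U'))^j d(U,U') = 0`. -/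
theorem integral_doubledMoment_eq_zero_two [NeZero L] (hρ : Continuous ρ) {F Gd : GaugeConfig 4 L G → ℝ}
    (hFm : Measurable F) (hGm : Measurable Gd) {CF CG : ℝ} (hFb : ∀ U, |F U| ≤ CF)
    (hGb : ∀ U, |Gd U| ≤ CG) (hF : DependsOn F {e : Edge 4 L | e.1 0 = 0 ∧ e.2 ≠ 0}) {n : ℕ}
    (hG : DependsOn Gd {e : Edge 4 L | e.1 0 = (n : ZMod L) ∧ e.2 ≠ 0}) (hnL : 2 * n < L) {j : ℕ}
    (hj : j < 2 * n) :
    ∫ W, F (fun e => W (Sum.inl e)) * (Gd (fun e => W (Sum.inl e)) - Gd (fun e => W (Sum.inr e))) *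
        (wilsonAction ρ (fun e => W (Sum.inl e)) + wilsonAction ρ (fun e => W (Sum.inr e))) ^ j
      ∂(Measure.pi fun _ : Edge 4 L ⊕ Edge 4 L => haarProbability G) = 0 := by
  have hL : 1 < L := by omega
  obtain ⟨B, hB0, hB⟩ := exists_bound_plaquetteCost (L := L) ρ hρ
  set Φ : (Edge 4 L ⊕ Edge 4 L → G) → ℝ := fun W =>
    F (fun e => W (Sum.inl e)) * (Gd (fun e => W (Sum.inl e)) - Gd (fun e => W (Sum.inr e))) with hΦ
  have hΦm : Measurable Φ :=
    (hFm.comp measurable_inl_copy).mul ((hGm.comp measurable_inl_copy).sub (hGm.comp measurable_inr_copy))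
  have hCF : 0 ≤ CF := le_trans (abs_nonneg _) (hFb fun _ => 1)
  have hCG : 0 ≤ CG := le_trans (abs_nonneg _) (hGb fun _ => 1)
  have hΦb : ∀ W, |Φ W| ≤ CF * (2 * CG) := fun W => by
    have hg1 := hGb (fun e => W (Sum.inl e))
    have hg2 := hGb (fun e => W (Sum.inr e))
    have hsub : |Gd (fun e => W (Sum.inl e)) - Gd (fun e => W (Sum.inr e))| ≤ 2 * CG :=
      le_trans (abs_sub _ _) (by linarith)
    rw [hΦ, abs_mul]
    exact mul_le_mul (hFb _) hsub (abs_nonneg _) hCF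
  have hdB : ∀ (p : Plaquette 4 L) (W : Edge 4 L ⊕ Edge 4 L → G), |dTerm ρ p W| ≤ 2 * B := fun p W => by
    have h1 := hB (fun e => W (Sum.inl e)) p
    have h2 := hB (fun e => W (Sum.inr e)) p
    unfold dTerm
    exact le_trans (abs_add_le _ _) (by linarith)
  have hexp : ∀ W : Edge 4 L ⊕ Edge 4 L → G,
      Φ W * (wilsonAction ρ (fun e => W (Sum.inl e)) + wilsonAction ρ (fun e => W (Sum.inr e))) ^ j =
        ∑ f : Fin j → Plaquette 4 L, Φ W * ∏ k, dTerm ρ (f k) W := fun W => by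
    rw [wilsonAction_add_eq_sum_dTerm, Fintype.sum_pow, Finset.mul_sum]
  have hterm_meas : ∀ f : Fin j → Plaquette 4 L,
      Measurable fun W => Φ W * ∏ k, dTerm ρ (f k) W := fun f =>
    hΦm.mul (Finset.measurable_prod _ fun k _ => measurable_dTerm ρ hρ (f k))
  have hterm_int : ∀ f : Fin j → Plaquette 4 L,
      Integrable (fun W => Φ W * ∏ k, dTerm ρ (f k) W)
        (Measure.pi fun _ : Edge 4 L ⊕ Edge 4 L => haarProbability G) := fun f => by
    refine Integrable.of_bound (C := CF * (2 * CG) * (2 * B) ^ j) (hterm_meas f).aestronglyMeasurable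
      (ae_of_all _ fun W => ?_)
    rw [Real.norm_eq_abs, abs_mul, Finset.abs_prod]
    have hprod : ∏ k, |dTerm ρ (f k) W| ≤ (2 * B) ^ j := by
      calc ∏ k, |dTerm ρ (f k) W| ≤ ∏ _k : Fin j, (2 * B) :=
            Finset.prod_le_prod (fun _ _ => abs_nonneg _) fun k _ => hdB (f k) W
        _ = (2 * B) ^ j := by simp
    exact mul_le_mul (hΦb W) hprod (Finset.prod_nonneg fun _ _ => abs_nonneg _)
      (mul_nonneg hCF (by linarith))
  have hvanish : ∀ f : Fin j → Plaquette 4 L,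
      ∫ W, Φ W * ∏ k, dTerm ρ (f k) W ∂(Measure.pi fun _ : Edge 4 L ⊕ Edge 4 L => haarProbability G)
        = 0 := fun f => by
    obtain ⟨t, t', x, jx, h0j, y, jy, h0j', htn, hnt', ht'L, hx, hy, hfx, hfy⟩ :=
      exists_thin_steps hj hnL f
    have c : CutData L n t t' x jx y jy :=
      ⟨hL, htn, hnt', ht'L, hx, hy, (ne_of_lt h0j).symm, (ne_of_lt h0j').symm⟩
    have hodd : ∀ W, Φ (sigma t t' x jx y jy W) * ∏ k, dTerm ρ (f k) (sigma t t' x jx y jy W) =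
        -(Φ W * ∏ k, dTerm ρ (f k) W) := fun W => integrand_sigma ρ c hF hG hfx hfy W
    have hinv := integral_comp_sigma (G := G) hL t t' x c.hj y c.hj' (hterm_meas f)
    rw [show (fun W => Φ (sigma t t' x jx y jy W) * ∏ k, dTerm ρ (f k) (sigma t t' x jx y jy W)) =
        fun W => -(Φ W * ∏ k, dTerm ρ (f k) W) from funext hodd, integral_neg] at hinv
    linarith
  calc ∫ W, Φ W * (wilsonAction ρ (fun e => W (Sum.inl e)) +
          wilsonAction ρ (fun e => W (Sum.inr e))) ^ j
        ∂(Measure.pi fun _ : Edge 4 L ⊕ Edge 4 L => haarProbability G)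
      = ∫ W, ∑ f : Fin j → Plaquette 4 L, Φ W * ∏ k, dTerm ρ (f k) W
          ∂(Measure.pi fun _ : Edge 4 L ⊕ Edge 4 L => haarProbability G) :=
        integral_congr_ae (ae_of_all _ hexp)
    _ = ∑ f : Fin j → Plaquette 4 L, ∫ W, Φ W * ∏ k, dTerm ρ (f k) W
          ∂(Measure.pi fun _ : Edge 4 L ⊕ Edge 4 L => haarProbability G) :=
        integral_finsetSum _ fun f _ => hterm_int f
    _ = 0 := Finset.sum_eq_zero fun f _ => hvanish f

end Moments

end Summit.QuantumFields.YangMills.Cruxes.IR.BetaSlopeFloor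

end
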